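import Summits.HodgeConjecture.HodgeConjecture.Theorems.R90S4TypeOneMemberPackage   -- ★ p864331 F3b (this seat): `exists_typeOne_memberPackage` (+ ★ F3a, F2a, F1, p12's (B2-S) dictionary vocabulary)
import Summits.HodgeConjecture.HodgeConjecture.Theorems.R90S4ConjOrbitCount         -- F5a (this seat): `natCard_conjOrbit_eq_index`, `mem_normalizer_of_conj_eq_of_centralizer_eq`, fibre counting, root permutation
import HarnessLib

/-!
# R90-TF · S4 «Ch. 13.1–2», (DICT)(1) file F5b — THE TYPE-(1) ROWS OF THE FINER WEYL COUNT: `#{j : T_j = T″} · [N(T″):T″] = 6` (Rogawski 1990, §12.5 p. 182)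

Cell `hodgecm-mathlib`, crux H413 (`stmt-HodgeConjecture-24833`, lane `--supports … --as helper`), route of record `HCCMUnconditional` (no route verbs; count-neutral).
Programme R90-TF, section S4 (base `R90-C131`), dealer K2E2-plan (g7), hand (DICT)(1) «`(E¹)³` TYPE», token F5; seat R90-C131-p01 (g2).  THEOREMS ONLY; ★-only imports + F5a.

## THE MATHEMATICS
`G_v = Gqs L v = U(Φ₃)(L⁺_v)`, `v` NON-SPLIT; `C` a Cartan system with the CARTAN-ALL letters (2) every member is `Z(γ)` for a regular `γ`, (4) every regular centraliser is
conjugate into a member, (5) members are pairwise non-conjugate; `T_i = Z(γ₀) ∈ C` of type (1) (`char γ₀ = ∏ₗ (X − uₗ)`, `u` injective, `σ(uₗ)uₗ = 1`), and `(τ, e)` the ★ F3b package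
(four transports `e j : T_i ≃ₜ* T_{τ j}` with (S)(W)(B)).  p. 182: «the number of `ν ∈ 𝔇(T∕F)` such that `T^ν` is conjugate to `T″` is `|Ω_F(T)|∕|Ω(T″)|`».  Here, VERBATIM:
fix a reachable member `T″ = k` and the regular point `γ₀ ∈ T_i`.  (a) By (B), `j ↦ ⟦e j γ₀⟧` is a bijection from `{j : τ j = k}` onto the `G_v`-classes in the stable class of `γ₀`
that MEET `k` (a class meeting `k` at a regular point has its torus conjugate to `k`, hence equal to `k` by letter (5)).  (b) The set `S_k = {t″ ∈ k : t″ ∼_{st} γ₀}` has exactly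
`6 = |S₃|` elements: `k = Z(s₁)` for the regular `s₁ = e j₀ γ₀` of type (1) (same characteristic polynomial), with eigenframe `Q`; the elements of `k` are `Q·diag(ν)·Q⁻¹` with
`σ(ν)ν = 1` (★ F2a), such an element is stably conjugate to `γ₀` iff its characteristic polynomial is `∏ (X − uₗ)` iff `ν = u ∘ π` for a unique `π ∈ S₃` (★ F1, F5a §3).  (c) Each
`G_v`-class meets `S_k` in exactly one `N_{G_v}(k)`-orbit, of size `[N(k):k]` (a conjugator between regular points of `k` normalises `k`; stabiliser `Z(t″) = k`; ★ F5a §1).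
HENCE `#{j : τ j = k} · [N(k):k] = |S_k| = 6` — clause (F1) of ★ `IsFinerCount` on type (1) with `wF ≡ 6`, WITHOUT the values `[N(k):k] ∈ {6, 2}` (★ F4, which become the checks
`# = 1, 3`).  Also: reachability `∃ j, τ j = k` ⟺ `T_i` and `k` carry stably conjugate regular points (symmetric; (F3)(F4)), and a reachable `k` is again of type (1) with the SAME
`u` ((F2): `μ ≡ 4`, `wF ≡ 6` along reachability).

## CONTENTS
* §1 `centralizer_eq_of_mem_member`, `member_eq_of_isConj` (letters (2)(5) at work), `isStablyConjGAt_of_charpoly_eq_prod`, `natCard_stableSet_eq_six` ((b)),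
  `natCard_fiber_mul_index_eq_six` ((a)+(c): the count from an abstract realised family).
* §2 `exists_typeOne_memberPackage_finer` — ★ F3b's package with the three finer-count rows (T1) reachability, (T2) `# · [N:T] = 6`, (T3) reachable members are type (1).

HONEST LABEL: HC_CM is proved only modulo the 7 printed citations (2 remaining named inputs: hLiu418 = stmt-HodgeConjecture-24832, h413 = stmt-HodgeConjecture-24833) until rung 0
closes.  The type-(1) rows of ★ `IsFinerCount` feed ★ p12's glue `isStableTransportDict_and_isTwistedWeylCountT_of_forall_member` behind ★ (B2-S) behind the OPEN (W-NP); discharges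
no named input.  REL ≠ ★ ≠ BUILT.

## References
* [Rogawski1990] J. D. Rogawski, *Automorphic Representations of Unitary Groups in Three Variables*, Ann. of Math. Stud. 123 (1990), §12.5 p. 182; §3.6 pp. 28–31; §3.5 Prop. 3.5.2
  p. 29; §3.1 p. 19.
* [Kottwitz1986] R. E. Kottwitz, *Stable trace formula: elliptic singular terms*, Math. Ann. 275 (1986), §7.
-/

set_option autoImplicit false
set_option linter.dupNamespace false

noncomputable section

open NumberField IsDedekindDomain Polynomial Matrix
open scoped MatrixGroups
open Literature.NumberTheory.Rogawski1990 Literature.NumberTheory.Automorphic Literature.NumberTheory.Automorphic.UnitaryGroup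
open Literature.AlgebraicGeometry.ShimuraVarieties (unitaryGroup mem_unitaryGroup_iff)
open Summit.HodgeConjecture.HodgeConjecture.Cruxes.H413

namespace Summit.HodgeConjecture.HodgeConjecture.R90.S4

section TypeOneFiner

variable (L : Type) [Field L] [NumberField L] [IsCMField L] (v : HeightOneSpectrum (𝓞 ↥(maximalRealSubfield L)))

variable {L v}

/-! ## §1 Members, classes, and the two counts -/

/-- Letter (2) at work: a member of the Cartan system containing a regular `s` IS `Z(s)` (★ `centralizer_eq_of_mem_centralizer`). [cite: Rogawski1990, §3.6 p. 28; §3.1 p. 19] -/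
theorem centralizer_eq_of_mem_member {Car : Finset (Subgroup (Gqs L v))}
    (hZ : ∀ T ∈ Car, ∃ γ : Gqs L v, IsRegularElt (γ.val : GL (Fin 3) (LocalRing L v)) ∧ T = Subgroup.centralizer ({γ} : Set (Gqs L v)))
    {T : Subgroup (Gqs L v)} (hT : T ∈ Car) {s : Gqs L v} (hs : s ∈ T) (hreg : IsRegularElt (s.val : GL (Fin 3) (LocalRing L v))) :
    Subgroup.centralizer ({s} : Set (Gqs L v)) = T := by
  obtain ⟨γ, hγ, rfl⟩ := hZ T hT
  exact F0P3cStCharTSCartanFields.centralizer_eq_of_mem_centralizer L v hγ hs hreg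

/-- Letters (2)+(5) at work: two members containing CONJUGATE regular elements are equal (`Z(z a z⁻¹) = z Z(a) z⁻¹`, ★ `centralizer_singleton_conj_eq_map`).
[cite: Rogawski1990, §3.6 p. 28; §12.5 p. 182] -/
theorem member_eq_of_isConj {Car : Finset (Subgroup (Gqs L v))}
    (hZ : ∀ T ∈ Car, ∃ γ : Gqs L v, IsRegularElt (γ.val : GL (Fin 3) (LocalRing L v)) ∧ T = Subgroup.centralizer ({γ} : Set (Gqs L v)))
    (hirr : ∀ T ∈ Car, ∀ T' ∈ Car, (∃ x : Gqs L v, T.map (MulAut.conj x).toMonoidHom = T') → T = T')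
    {T T' : Subgroup (Gqs L v)} (hT : T ∈ Car) (hT' : T' ∈ Car) {a b : Gqs L v} (ha : a ∈ T) (hb : b ∈ T')
    (hareg : IsRegularElt (a.val : GL (Fin 3) (LocalRing L v))) (hbreg : IsRegularElt (b.val : GL (Fin 3) (LocalRing L v))) (h : IsConj a b) :
    T = T' := by
  obtain ⟨c, hc⟩ := isConj_iff.1 h
  refine hirr T hT T' hT' ⟨c, ?_⟩
  rw [← centralizer_eq_of_mem_member hZ hT ha hareg, ← centralizer_eq_of_mem_member hZ hT' hb hbreg, ← hc, centralizer_singleton_conj_eq_map]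

/-- Two elements of `G_v` whose characteristic polynomials are the same split separable cubic `∏ₗ (X − uₗ)` are stably conjugate (both are `GL₃`-conjugate to `diag(u)`, ★ F1
`exists_units_conj_diagonal_of_charpoly_eq_prod`). [cite: Rogawski1990, §3.1 p. 19; §3.6 p. 30] -/
theorem isStablyConjGAt_of_charpoly_eq_prod (hns : ∀ w : PlacesOver L v, IsCMField.complexConj L • w.1 = w.1) {t s : Gqs L v} {u : Fin 3 → LocalRing L v}
    (hu : Function.Injective u) (ht : t.val.val.charpoly = ∏ l, (X - C (u l))) (hs : s.val.val.charpoly = ∏ l, (X - C (u l))) :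
    IsStablyConjGAt L (R90.S4.splitFormGL L) v t s := by
  obtain ⟨w⟩ := (inferInstance : Nonempty (PlacesOver L v))
  letI : Field (LocalRing L v) := (LocalRing.isField_of_smul_eq (IsCMField.complexConj L) (IsCMField.complexConj_ne_one L) w (hns w)).toField
  obtain ⟨P₁, h1⟩ := exists_units_conj_diagonal_of_charpoly_eq_prod t.val.val u hu ht
  obtain ⟨P₂, h2⟩ := exists_units_conj_diagonal_of_charpoly_eq_prod s.val.val u hu hs
  refine (isStablyConjGAt_iff_exists_conj_eq t s).2 ⟨P₂ * P₁⁻¹, Units.ext ?_⟩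
  have e1 : ∀ X' : Matrix (Fin 3) (Fin 3) (LocalRing L v), P₁⁻¹.val * (P₁.val * X') = X' := fun X' => by
    rw [← Matrix.mul_assoc, units_inv_mul_val, Matrix.one_mul]
  rw [_root_.mul_inv_rev, inv_inv]
  simp only [Units.val_mul]
  rw [h2, h1]
  calc P₂.val * P₁⁻¹.val * (P₁.val * diagonal u * P₁⁻¹.val) * (P₁.val * P₂⁻¹.val)
      = P₂.val * (P₁⁻¹.val * (P₁.val * (diagonal u * (P₁⁻¹.val * (P₁.val * P₂⁻¹.val))))) := by simp only [Matrix.mul_assoc]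
    _ = P₂.val * diagonal u * P₂⁻¹.val := by rw [e1, e1, Matrix.mul_assoc]

/-- **`|{t″ ∈ k : t″ ∼_{st} t}| = 6 = |S₃|`** for a type-(1) torus `k = Z(s₁)` (`char s₁ = ∏ₗ (X − uₗ)`, `u` injective, `σ(uₗ)uₗ = 1`) and any `t` with the same characteristic
polynomial (`v` non-split): in an eigenframe `Q` of `s₁` the elements of `k` are `Q·diag(ν)·Q⁻¹`, `σ(ν)ν = 1` (★ F2a), and such an element is stably conjugate to `t` iff `char = ∏ (X − uₗ)` iff
`ν = u ∘ π`, `π ∈ S₃` unique (★ F1 `conj_diagonal_injective`, ★ F5a `exists_perm_eq_comp_of_prod_X_sub_C_eq`). [cite: Rogawski1990, §12.5 p. 182; §3.6 p. 30] -/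
theorem natCard_stableSet_eq_six (hns : ∀ w : PlacesOver L v, IsCMField.complexConj L • w.1 = w.1) {K : Subgroup (Gqs L v)} {s₁ t : Gqs L v} {u : Fin 3 → LocalRing L v}
    (hu : Function.Injective u) (hu1 : ∀ l, conjLocal L (IsCMField.complexConj L) v (u l) * u l = 1)
    (hs₁ : s₁.val.val.charpoly = ∏ l, (X - C (u l))) (hK : Subgroup.centralizer ({s₁} : Set (Gqs L v)) = K)
    (ht : t.val.val.charpoly = ∏ l, (X - C (u l))) :
    Nat.card {s : ↥K // IsStablyConjGAt L (R90.S4.splitFormGL L) v t (s : Gqs L v)} = 6 := by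
  classical
  subst hK
  obtain ⟨w⟩ := (inferInstance : Nonempty (PlacesOver L v))
  letI : Field (LocalRing L v) := (LocalRing.isField_of_smul_eq (IsCMField.complexConj L) (IsCMField.complexConj_ne_one L) w (hns w)).toField
  have hH : IsUnit (cmLocalForm L 3 v).det := by
    rw [cmLocalForm_eq_over]; exact (Matrix.isUnit_iff_isUnit_det _).1 ((StdForm.antidiagonal 3).isUnit_over _)
  have hs₁U : s₁.val ∈ unitaryGroup (conjLocal L (IsCMField.complexConj L) v) (cmLocalForm L 3 v) := by
    rw [← unitaryGroupOfForm_cmLocalForm_eq_unitaryGroup]; exact s₁.2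
  -- an eigenframe of `s₁`
  obtain ⟨Q, hQ⟩ := Literature.NumberTheory.Rogawski1990.exists_eigenframe_of_charpoly_eq_prod s₁.val u hu hs₁
  have hQ' : s₁.val.val = Q.val * diagonal u * Q⁻¹.val := by rw [← hQ, Matrix.mul_assoc, units_mul_inv_val, Matrix.mul_one]
  have hu0 : ∀ l, u l ≠ 0 := fun l h0 => by
    have h1 := hu1 l
    rw [h0, mul_zero] at h1
    exact zero_ne_one h1
  -- the six elements `Q·diag(u ∘ π)·Q⁻¹`
  have hdet : ∀ π : Equiv.Perm (Fin 3), (Q.val * diagonal (u ∘ π) * Q⁻¹.val).det ≠ 0 := fun π => by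
    rw [det_conj_diagonal_eq_prod]
    exact Finset.prod_ne_zero_iff.2 fun l _ => hu0 (π l)
  have hMU : ∀ π : Equiv.Perm (Fin 3), Matrix.GeneralLinearGroup.mkOfDetNeZero _ (hdet π) ∈
      unitaryGroupOfForm (conjLocal L (IsCMField.complexConj L) v) (cmLocalForm L 3 v) := by
    intro π
    rw [unitaryGroupOfForm_cmLocalForm_eq_unitaryGroup, ← twistGram_coe_eq_iff_mem_unitaryGroup]
    show twistGram (conjLocal L (IsCMField.complexConj L) v) (cmLocalForm L 3 v) (Q.val * diagonal (u ∘ π) * Q⁻¹.val) = cmLocalForm L 3 v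
    have h1 : twistGram (conjLocal L (IsCMField.complexConj L) v) (cmLocalForm L 3 v) (1 : Matrix (Fin 3) (Fin 3) (LocalRing L v)) =
        cmLocalForm L 3 v * (Q.val * diagonal (fun _ => (1 : LocalRing L v)) * Q⁻¹.val) := by
      rw [twistGram_one, diagonal_one, Matrix.mul_one, units_mul_inv_val, Matrix.mul_one]
    have h2 := twistGram_mul_conj_diagonal (conjLocal L (IsCMField.complexConj L) v) (cmLocalForm L 3 v) hs₁U hu hu1 Q hQ' hH h1 (u ∘ π)
    rw [Matrix.one_mul] at h2
    have h3 : (fun l => conjLocal L (IsCMField.complexConj L) v ((u ∘ π) l) * 1 * (u ∘ π) l) = fun _ => (1 : LocalRing L v) :=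
      funext fun l => by rw [mul_one, Function.comp_apply, hu1]
    rw [h2, h3, diagonal_one, Matrix.mul_one, units_mul_inv_val, Matrix.mul_one]
  have hMZ : ∀ π : Equiv.Perm (Fin 3), (⟨_, hMU π⟩ : Gqs L v) ∈ Subgroup.centralizer ({s₁} : Set (Gqs L v)) := by
    intro π
    refine Subgroup.mem_centralizer_singleton_iff.2 (Subtype.ext (Units.ext ?_))
    show Q.val * diagonal (u ∘ π) * Q⁻¹.val * s₁.val.val = s₁.val.val * (Q.val * diagonal (u ∘ π) * Q⁻¹.val)
    rw [hQ']
    exact (commute_conj_diagonal Q (u ∘ π) u).eq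
  have hMchar : ∀ π : Equiv.Perm (Fin 3), (((⟨_, hMU π⟩ : Gqs L v)).val).val.charpoly = ∏ l, (X - C (u l)) := by
    intro π
    show (Q.val * diagonal (u ∘ π) * Q⁻¹.val).charpoly = ∏ l, (X - C (u l))
    rw [Matrix.coe_units_inv, Matrix.charpoly_units_conj, charpoly_diagonal]
    exact Equiv.prod_comp π (fun l => X - C (u l))
  have hMst : ∀ π : Equiv.Perm (Fin 3), IsStablyConjGAt L (R90.S4.splitFormGL L) v t (⟨_, hMU π⟩ : Gqs L v) :=
    fun π => isStablyConjGAt_of_charpoly_eq_prod hns hu ht (hMchar π)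
  let Ψ : Equiv.Perm (Fin 3) → {s : ↥(Subgroup.centralizer ({s₁} : Set (Gqs L v))) // IsStablyConjGAt L (R90.S4.splitFormGL L) v t (s : Gqs L v)} :=
    fun π => ⟨⟨⟨_, hMU π⟩, hMZ π⟩, hMst π⟩
  have hΨval : ∀ π, ((((Ψ π).1 : Gqs L v)).val).val = Q.val * diagonal (u ∘ π) * Q⁻¹.val := fun π => rfl
  have hΨinj : Function.Injective Ψ := by
    intro π π' h
    have h1 : Q.val * diagonal (u ∘ π) * Q⁻¹.val = Q.val * diagonal (u ∘ π') * Q⁻¹.val := by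
      rw [← hΨval π, ← hΨval π', h]
    exact Equiv.ext fun l => hu (congrFun (conj_diagonal_injective Q h1) l)
  have hΨsurj : Function.Surjective Ψ := by
    intro s
    have hsU : ((s.1 : Gqs L v)).val ∈ unitaryGroup (conjLocal L (IsCMField.complexConj L) v) (cmLocalForm L 3 v) := by
      rw [← unitaryGroupOfForm_cmLocalForm_eq_unitaryGroup]; exact (s.1 : Gqs L v).2
    have hsc : Commute ((s.1 : Gqs L v)).val.val s₁.val.val :=
      congrArg (fun g : Gqs L v => g.val.val) (Subgroup.mem_centralizer_singleton_iff.1 s.1.2)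
    obtain ⟨ν, hν, -⟩ := exists_eq_conj_diagonal_of_mem_unitaryGroup_of_commute (conjLocal L (IsCMField.complexConj L) v) (cmLocalForm L 3 v)
      hs₁U hu hu1 Q hQ' hH hsU hsc
    have hchar : ∏ l, (X - C (ν l)) = ∏ l, (X - C (u l)) := by
      rw [← ht, ← charpoly_eq_of_isStablyConjGAt s.2, hν, Matrix.coe_units_inv, Matrix.charpoly_units_conj, charpoly_diagonal]
    obtain ⟨π, hπ⟩ := exists_perm_eq_comp_of_prod_X_sub_C_eq hu hchar
    refine ⟨π, Subtype.ext (Subtype.ext (Subtype.ext (Units.ext ?_)))⟩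
    rw [hΨval, hν, hπ]
  rw [← Nat.card_congr (Equiv.ofBijective Ψ ⟨hΨinj, hΨsurj⟩), Nat.card_eq_fintype_card, Fintype.card_perm, Fintype.card_fin]
  rfl

/-- **`#{j : T_j = k} · [N(k):k] = 6`, FROM AN ABSTRACT REALISED FAMILY** (`v` non-split).  Data: a Cartan system `C` with letters (2) and (5); a type-(1) regular `γ₀` (`char = ∏ (X − uₗ)`,
`u` injective, `σ(uₗ)uₗ = 1`); a family `a : Fin 4 → G_v` of stable conjugates of `γ₀` lying in members `T j ∈ C`, INJECTIVE on classes and EXHAUSTING the classes of the stable class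
of `γ₀` (the (B) clause of the package at `γ₀`); and a member `k ∈ C` hit by the family.  Then `Nat.card {j // T j = k} · [N(k):k] = 6` — the classes meeting `k` are counted by
`{j // T j = k}`, each meets `{t″ ∈ k : t″ ∼_{st} γ₀}` (six elements, `natCard_stableSet_eq_six`) in one `N(k)`-orbit of size `[N(k):k]` (★ F5a). [cite: Rogawski1990, §12.5 p. 182; §3.6 pp. 28–31] -/
theorem natCard_fiber_mul_index_eq_six (hns : ∀ w : PlacesOver L v, IsCMField.complexConj L • w.1 = w.1) {Car : Finset (Subgroup (Gqs L v))}
    (hZ : ∀ T ∈ Car, ∃ γ : Gqs L v, IsRegularElt (γ.val : GL (Fin 3) (LocalRing L v)) ∧ T = Subgroup.centralizer ({γ} : Set (Gqs L v)))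
    (hirr : ∀ T ∈ Car, ∀ T' ∈ Car, (∃ x : Gqs L v, T.map (MulAut.conj x).toMonoidHom = T') → T = T')
    {γ₀ : Gqs L v} {u : Fin 3 → LocalRing L v} (hu : Function.Injective u) (hu1 : ∀ l, conjLocal L (IsCMField.complexConj L) v (u l) * u l = 1)
    (hchar : γ₀.val.val.charpoly = ∏ l, (X - C (u l)))
    {a : Fin 4 → Gqs L v} {T : Fin 4 → Subgroup (Gqs L v)} (hTmem : ∀ j, T j ∈ Car) (haT : ∀ j, a j ∈ T j)
    (hast : ∀ j, IsStablyConjGAt L (R90.S4.splitFormGL L) v γ₀ (a j))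
    (hainj : ∀ j j', ConjClasses.mk (a j) = ConjClasses.mk (a j') → j = j')
    (hasurj : ∀ s : Gqs L v, IsStablyConjGAt L (R90.S4.splitFormGL L) v γ₀ s → ∃ j, ConjClasses.mk (a j) = ConjClasses.mk s)
    {k : Subgroup (Gqs L v)} (hk : k ∈ Car) (hjk : ∃ j, T j = k) :
    Nat.card {j : Fin 4 // T j = k} * (k.subgroupOf (Subgroup.normalizer (k : Set (Gqs L v)))).index = 6 := by
  classical
  obtain ⟨w⟩ := (inferInstance : Nonempty (PlacesOver L v))
  letI : Field (LocalRing L v) := (LocalRing.isField_of_smul_eq (IsCMField.complexConj L) (IsCMField.complexConj_ne_one L) w (hns w)).toField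
  have hreg₀ : IsRegularElt (γ₀.val : GL (Fin 3) (LocalRing L v)) := by
    rw [isRegularElt_iff, hchar]; exact separable_prod_X_sub_C_iff.2 hu
  have hareg : ∀ j, IsRegularElt ((a j).val : GL (Fin 3) (LocalRing L v)) := fun j => isRegularElt_of_isConj (hast j) hreg₀
  have hachar : ∀ j, (a j).val.val.charpoly = ∏ l, (X - C (u l)) := fun j => by rw [charpoly_eq_of_isStablyConjGAt (hast j), hchar]
  have haZ : ∀ j, Subgroup.centralizer ({a j} : Set (Gqs L v)) = T j := fun j => centralizer_eq_of_mem_member hZ (hTmem j) (haT j) (hareg j)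
  -- every regular stable conjugate of `γ₀` inside a member `T'` pins the member: `T j = T'` for the `j` of its class
  have hpin : ∀ {T' : Subgroup (Gqs L v)}, T' ∈ Car → ∀ {s : Gqs L v}, s ∈ T' → IsStablyConjGAt L (R90.S4.splitFormGL L) v γ₀ s →
      ∀ j, ConjClasses.mk (a j) = ConjClasses.mk s → T j = T' := by
    intro T' hT' s hs hst j hj
    exact member_eq_of_isConj hZ hirr (hTmem j) hT' (haT j) hs (hareg j) (isRegularElt_of_isConj hst hreg₀) (ConjClasses.mk_eq_mk_iff_isConj.1 hj)
  obtain ⟨j₀, hj₀⟩ := hjk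
  -- (b) the six-element set
  have hK1 : Subgroup.centralizer ({a j₀} : Set (Gqs L v)) = k := by rw [haZ j₀, hj₀]
  have hS6 : Nat.card {s : ↥k // IsStablyConjGAt L (R90.S4.splitFormGL L) v γ₀ (s : Gqs L v)} = 6 :=
    natCard_stableSet_eq_six hns hu hu1 (hachar j₀) hK1 hchar
  haveI : Finite {s : ↥k // IsStablyConjGAt L (R90.S4.splitFormGL L) v γ₀ (s : Gqs L v)} := Nat.finite_of_card_ne_zero (by rw [hS6]; decide)
  -- (a) the class map onto `{j // T j = k}`
  have hfex : ∀ s : {s : ↥k // IsStablyConjGAt L (R90.S4.splitFormGL L) v γ₀ (s : Gqs L v)},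
      ∃ j : {j : Fin 4 // T j = k}, ConjClasses.mk (a j.1) = ConjClasses.mk ((s.1 : Gqs L v)) := by
    intro s
    obtain ⟨j, hj⟩ := hasurj (s.1 : Gqs L v) s.2
    exact ⟨⟨j, hpin hk (s.1).2 s.2 j hj⟩, hj⟩
  choose f hf using hfex
  -- (c) each fibre is one `N(k)`-orbit of a regular point of `k`
  have hfib : ∀ j : {j : Fin 4 // T j = k}, Nat.card {s // f s = j} = (k.subgroupOf (Subgroup.normalizer (k : Set (Gqs L v)))).index := by
    intro j
    have hajk : a j.1 ∈ k := by
      have h := haT j.1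
      rw [j.2] at h
      exact h
    have hZj : Subgroup.centralizer ({a j.1} : Set (Gqs L v)) = k := by rw [haZ j.1, j.2]
    rw [← natCard_conjOrbit_eq_index k hZj]
    refine Nat.card_congr (Equiv.ofBijective (fun s => ⟨((s.1.1 : Gqs L v)), ?_⟩) ⟨?_, ?_⟩)
    · -- the class of `s` is the class of `a j`: a conjugator normalises `k`
      have h1 : ConjClasses.mk (a j.1) = ConjClasses.mk ((s.1.1 : Gqs L v)) := by
        have h0 := hf s.1
        rw [s.2] at h0
        exact h0
      obtain ⟨c, hc'⟩ := isConj_iff.1 (ConjClasses.mk_eq_mk_iff_isConj.1 h1)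
      have hsZ : Subgroup.centralizer ({((s.1.1 : Gqs L v))} : Set (Gqs L v)) = k :=
        centralizer_eq_of_mem_member hZ hk (s.1.1).2 (isRegularElt_of_isConj s.1.2 hreg₀)
      exact ⟨c, mem_normalizer_of_conj_eq_of_centralizer_eq hZj hsZ hc', hc'⟩
    · intro s s' h
      simp only [Subtype.mk.injEq] at h
      exact Subtype.ext (Subtype.ext (Subtype.ext h))
    · rintro ⟨s', n, hn, hns'⟩
      have hs'k : s' ∈ k := by rw [← hns']; exact (Subgroup.mem_normalizer_iff.1 hn (a j.1)).1 hajk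
      have hconj : IsConj (a j.1) s' := isConj_iff.2 ⟨n, hns'⟩
      have hst' : IsStablyConjGAt L (R90.S4.splitFormGL L) v γ₀ s' := IsConj.trans (hast j.1) (isStablyConjGAt_of_isConj hconj)
      let s₀ : {s : ↥k // IsStablyConjGAt L (R90.S4.splitFormGL L) v γ₀ (s : Gqs L v)} := ⟨⟨s', hs'k⟩, hst'⟩
      have hfs₀ : f s₀ = j := by
        apply Subtype.ext
        apply hainj
        rw [hf s₀]
        exact (ConjClasses.mk_eq_mk_iff_isConj.2 hconj).symm
      exact ⟨⟨s₀, hfs₀⟩, rfl⟩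
  have hcount := natCard_eq_natCard_mul_of_natCard_fiber_eq f _ hfib
  rw [hS6] at hcount
  exact hcount.symm

/-! ## §2 The type-(1) package with its finer-count rows -/

/-- **THE TYPE-(1) MEMBER PACKAGE WITH THE FINER-COUNT ROWS** (`v` non-split; Cartan system with CARTAN-ALL letters (2) `hZ`, (4) `hcov`, (5) `hirr`; `T_i = Z(γ₀)` of type (1)).
The ★ F3b package `(τ, e)` with (S)(W)(B), and moreover: (T1) REACHABILITY — `(∃ j, τ j = k) ↔` some regular `t ∈ T_i` is stably conjugate to some `t″ ∈ k` (symmetric in the two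
members; gives (F3)(F4) of ★ `IsFinerCount`); (T2) THE COUNT — `#{j : τ j = k} · [N(k):k] = 6` for every reachable `k` ((F1) with `wF ≡ 6` on type (1); p. 182); (T3) a reachable
`k` is `Z(γ′)` for a `γ′` with the SAME type-(1) letter `u` ((F2): `μ ≡ 4`, `wF ≡ 6` along reachability). [cite: Rogawski1990, §12.5 p. 182; §3.6 pp. 28–31; §3.5 Prop. 3.5.2 (c) p. 29]
[cite: Kottwitz1986, §7] -/
theorem exists_typeOne_memberPackage_finer (hns : ∀ w : PlacesOver L v, IsCMField.complexConj L • w.1 = w.1) {Car : Finset (Subgroup (Gqs L v))} (i : ↥Car)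
    {γ₀ : Gqs L v} {u : Fin 3 → LocalRing L v} (hu : Function.Injective u) (hu1 : ∀ k, conjLocal L (IsCMField.complexConj L) v (u k) * u k = 1)
    (hchar : γ₀.val.val.charpoly = ∏ k, (X - C (u k))) (hi : (i : Subgroup (Gqs L v)) = Subgroup.centralizer ({γ₀} : Set (Gqs L v)))
    (hZ : ∀ T ∈ Car, ∃ γ : Gqs L v, IsRegularElt (γ.val : GL (Fin 3) (LocalRing L v)) ∧ T = Subgroup.centralizer ({γ} : Set (Gqs L v)))
    (hcov : ∀ γ : Gqs L v, IsRegularElt (γ.val : GL (Fin 3) (LocalRing L v)) →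
      ∃ T ∈ Car, ∃ x : Gqs L v, Subgroup.centralizer ({γ} : Set (Gqs L v)) = T.map (MulAut.conj x).toMonoidHom)
    (hirr : ∀ T ∈ Car, ∀ T' ∈ Car, (∃ x : Gqs L v, T.map (MulAut.conj x).toMonoidHom = T') → T = T') :
    ∃ (τ : Fin 4 → ↥Car) (e : ∀ j : Fin 4, ↥(i : Subgroup (Gqs L v)) ≃ₜ* ↥((τ j : ↥Car) : Subgroup (Gqs L v))),
      (∀ (j : Fin 4) (t : ↥(i : Subgroup (Gqs L v))),
          IsStablyConjGAt L (R90.S4.splitFormGL L) v (t : Gqs L v) ((e j t : ↥((τ j : ↥Car) : Subgroup (Gqs L v))) : Gqs L v)) ∧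
      (∀ (j : Fin 4) (t : ↥(i : Subgroup (Gqs L v))), IsRegularElt (((t : Gqs L v)).val : GL (Fin 3) (LocalRing L v)) →
          cartanWeight L v ((τ j : ↥Car) : Subgroup (Gqs L v)) (e j t) = cartanWeight L v (i : Subgroup (Gqs L v)) t) ∧
      (∀ t : ↥(i : Subgroup (Gqs L v)), IsRegularElt (((t : Gqs L v)).val : GL (Fin 3) (LocalRing L v)) →
          Set.BijOn (fun j : Fin 4 => ConjClasses.mk ((e j t : ↥((τ j : ↥Car) : Subgroup (Gqs L v))) : Gqs L v)) Set.univ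
            {c : ConjClasses (Gqs L v) | IsStablyConjGAt L (R90.S4.splitFormGL L) v (t : Gqs L v) (Quotient.out c)}) ∧
      (∀ k : ↥Car, (∃ j, τ j = k) ↔ ∃ (t : ↥(i : Subgroup (Gqs L v))) (t'' : ↥(k : Subgroup (Gqs L v))),
          IsRegularElt (((t : Gqs L v)).val : GL (Fin 3) (LocalRing L v)) ∧ IsStablyConjGAt L (R90.S4.splitFormGL L) v (t : Gqs L v) (t'' : Gqs L v)) ∧
      (∀ k : ↥Car, (∃ j, τ j = k) →
          Nat.card {j : Fin 4 // τ j = k} * (((k : Subgroup (Gqs L v)).subgroupOf (Subgroup.normalizer ((k : Subgroup (Gqs L v)) : Set (Gqs L v)))).index) = 6) ∧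
      (∀ k : ↥Car, (∃ j, τ j = k) → ∃ γ' : Gqs L v,
          γ'.val.val.charpoly = ∏ l, (X - C (u l)) ∧ (k : Subgroup (Gqs L v)) = Subgroup.centralizer ({γ'} : Set (Gqs L v))) := by
  classical
  obtain ⟨τ, e, hS, hW, hB, -⟩ := exists_typeOne_memberPackage hns i hu hu1 hchar hi hcov
  obtain ⟨w⟩ := (inferInstance : Nonempty (PlacesOver L v))
  letI : Field (LocalRing L v) := (LocalRing.isField_of_smul_eq (IsCMField.complexConj L) (IsCMField.complexConj_ne_one L) w (hns w)).toField
  have hreg₀ : IsRegularElt (γ₀.val : GL (Fin 3) (LocalRing L v)) := by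
    rw [isRegularElt_iff, hchar]; exact separable_prod_X_sub_C_iff.2 hu
  have hγ₀i : γ₀ ∈ (i : Subgroup (Gqs L v)) := by rw [hi]; exact Subgroup.mem_centralizer_singleton_iff.2 rfl
  -- the regular base point `γ₀ ∈ T_i` and the realised family `a j = e j γ₀ ∈ T_{τ j}`
  set t₀ : ↥(i : Subgroup (Gqs L v)) := ⟨γ₀, hγ₀i⟩ with ht₀
  have hpin : ∀ (t : ↥(i : Subgroup (Gqs L v))), IsRegularElt (((t : Gqs L v)).val : GL (Fin 3) (LocalRing L v)) →
      ∀ (k : ↥Car) (s : Gqs L v), s ∈ (k : Subgroup (Gqs L v)) → IsStablyConjGAt L (R90.S4.splitFormGL L) v (t : Gqs L v) s →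
      ∀ j, ConjClasses.mk ((e j t : ↥((τ j : ↥Car) : Subgroup (Gqs L v))) : Gqs L v) = ConjClasses.mk s → τ j = k := by
    intro t ht k s hs hst j hj
    exact Subtype.ext (member_eq_of_isConj hZ hirr (τ j).2 k.2 (e j t).2 hs (isRegularElt_of_isConj (hS j t) ht) (isRegularElt_of_isConj hst ht)
      (ConjClasses.mk_eq_mk_iff_isConj.1 hj))
  have hT3 : ∀ k : ↥Car, (∃ j, τ j = k) → ∃ γ' : Gqs L v,
      γ'.val.val.charpoly = ∏ l, (X - C (u l)) ∧ (k : Subgroup (Gqs L v)) = Subgroup.centralizer ({γ'} : Set (Gqs L v)) := by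
    rintro k ⟨j, rfl⟩
    refine ⟨(e j t₀ : Gqs L v), by rw [charpoly_eq_of_isStablyConjGAt (hS j t₀), hchar], ?_⟩
    exact (centralizer_eq_of_mem_member hZ (τ j).2 (e j t₀).2 (isRegularElt_of_isConj (hS j t₀) hreg₀)).symm
  refine ⟨τ, e, hS, hW, hB, fun k => ⟨?_, ?_⟩, fun k hk => ?_, hT3⟩
  · rintro ⟨j, rfl⟩
    exact ⟨t₀, ⟨(e j t₀ : Gqs L v), (e j t₀).2⟩, hreg₀, hS j t₀⟩
  · rintro ⟨t, t'', ht, hst⟩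
    have hc : ConjClasses.mk (t'' : Gqs L v) ∈ {c : ConjClasses (Gqs L v) | IsStablyConjGAt L (R90.S4.splitFormGL L) v (t : Gqs L v) (Quotient.out c)} :=
      IsConj.trans hst (mk_mem_stableIndexSet (t'' : Gqs L v))
    obtain ⟨j, -, hj⟩ := (hB t ht).2.2 hc
    exact ⟨j, hpin t ht k (t'' : Gqs L v) t''.2 hst j hj⟩
  · -- (T2): the count from the abstract lemma, with `a j := e j γ₀`, `T j := τ j`
    have h6 := natCard_fiber_mul_index_eq_six hns hZ hirr hu hu1 hchar
      (a := fun j => ((e j t₀ : ↥((τ j : ↥Car) : Subgroup (Gqs L v))) : Gqs L v)) (T := fun j => ((τ j : ↥Car) : Subgroup (Gqs L v)))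
      (fun j => (τ j).2) (fun j => (e j t₀).2) (fun j => hS j t₀)
      (fun j j' h => (hB t₀ hreg₀).2.1 (Set.mem_univ j) (Set.mem_univ j') h)
      (fun s hs => by
        obtain ⟨j, -, hj⟩ := (hB t₀ hreg₀).2.2 (show ConjClasses.mk s ∈ {c : ConjClasses (Gqs L v) |
            IsStablyConjGAt L (R90.S4.splitFormGL L) v (t₀ : Gqs L v) (Quotient.out c)} from IsConj.trans hs (mk_mem_stableIndexSet s))
        exact ⟨j, hj⟩)
      k.2 (by obtain ⟨j, hj⟩ := hk; exact ⟨j, by rw [hj]⟩)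
    have hcard : Nat.card {j : Fin 4 // τ j = k} = Nat.card {j : Fin 4 // ((τ j : ↥Car) : Subgroup (Gqs L v)) = (k : Subgroup (Gqs L v))} :=
      Nat.card_congr (Equiv.subtypeEquivRight fun j => Subtype.ext_iff)
    rw [hcard]
    exact h6

end TypeOneFiner

end Summit.HodgeConjecture.HodgeConjecture.R90.S4

end
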